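import Summits.AtomisticToContinuum.Crystallization.Theorems.OverbindingBudgetAffineFarFieldCollarWindow
import Summits.AtomisticToContinuum.Crystallization.Theorems.OverbindingBudgetAffineFarFieldCollarForms

/-!
# Overbinding budget, affine far field — «CollarAtlas»: the decidable atlas conditions and their soundness

Support file for `Summit.AtomisticToContinuum.Crystallization.Theses.OverbindingBudget.RobustDefectLimitWindows`
(sub-problem (2c), leaf SW♭(30), part 27V, interface row (R*), soundness side «27VI-SOUND», integer part). The K-file of the
27V-I certificate fixes a word window of `s`, a centre site `u₀`, the core form bound `Kc = 12ρc²` (`1728` at `ρc = 12`), the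
piece list `I`, an INTEGER width table `wN` (widths `w u = ν·wN u/D`) supported on a finite band set `B`, integer tube books `WN`
(`W k = ν·WN k/D`), a scale `D > 0` and an integer `cN ≥ 0` with `D² ≤ 2cN²` (`cN/D ≥ 1/√2`); it discharges by `decide` the FINITE
INTEGER conditions (no `ℚ` in the kernel: fixed-point like the other K files)

* (A1) `∀ u ∈ barlowBox u₀ Ll La Lb, F(u,u₀) ≤ Kc → ∀ u' ∈ barlowNbrBox u, F(u,u') ≤ 24 → Kc < F(u',u₀) → (u,u') ∈ I`,
* (A3) `∀ u ∈ B, ∀ k ∈ I, D²·(2F(u,k.1) + 2F(u,k.2) − F(k.1,k.2)) ≤ 12·(2cN + 4·wN u + pieceRadiusN k)² → wN u ≤ WN k`,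
* (A4) `∀ k ∈ I, 0 ≤ WN k`

(`F = barlowSiteForm s`, `pieceRadiusN k = D` for a bond, `0` otherwise), and this file turns them into the hypotheses `hI`, `hWd`,
`hW0` of `CollarWindow.interfaceRow_window` for `q₀ = placedSite s ν q R u₀`, `r_c = ν·ρc`, `r₀ = ν/√2` (★ `hI_of_atlas`,
★ `hWd_of_atlas`). The search boxes are complete by «CollarForms» `coord_sq_le_of_barlowSiteForm_le`; the star test is Apollonius in
integer form. (`hI'` is itself decidable on `I`.) KERNEL SANITY (scratch, `decide`): the hcp origin has exactly 12 form-12 and 6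
form-24 sites in `barlowNbrBox`.
[this file]
-/

namespace Summit.AtomisticToContinuum.Crystallization.Theorems.OverbindingBudgetAffineFarFieldCollarAtlas

noncomputable section

open Set Metric
open Literature.MathematicalPhysics.StatisticalMechanics (IsHaggSeq)
open Summit.AtomisticToContinuum.Crystallization.Theorems.OverbindingBudgetAffineFarFieldCollarSites
open Summit.AtomisticToContinuum.Crystallization.Theorems.OverbindingBudgetAffineFarFieldCollarWindow
open Summit.AtomisticToContinuum.Crystallization.Theorems.OverbindingBudgetAffineFarFieldCollarForms

local notation "E3" => EuclideanSpace ℝ (Fin 3)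
local notation "Idx" => ℤ × ℤ × ℤ

/-! ## §1 Search boxes (computable: `Finset.range` images, no order instances) -/

/-- The integer interval `[c − L, c + L]` as a computable `Finset`. -/
def barlowRange (c : ℤ) (L : ℕ) : Finset ℤ := (Finset.range (2 * L + 1)).image fun i : ℕ => c - L + i

/-- support: membership in the Barlow layer range `[c − L, c + L]`. [this file] -/
theorem mem_barlowRange_iff {c x : ℤ} {L : ℕ} : x ∈ barlowRange c L ↔ c - L ≤ x ∧ x ≤ c + L := by
  simp only [barlowRange, Finset.mem_image, Finset.mem_range]
  constructor
  · rintro ⟨i, hi, rfl⟩; omega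
  · rintro ⟨h1, h2⟩; exact ⟨(x - (c - L)).toNat, by omega, by omega⟩

/-- The coordinate box about `u₀` with layer radius `Ll`, first in-layer radius `La`, second in-layer radius `Lb`. -/
def barlowBox (u₀ : Idx) (Ll La Lb : ℕ) : Finset Idx :=
  barlowRange u₀.1 Ll ×ˢ (barlowRange u₀.2.1 La ×ˢ barlowRange u₀.2.2 Lb)

/-- The neighbour box of a site: all sites of form `≤ 24` lie in it (`|Δl| ≤ 1`, `|Δa| ≤ 3`, `|Δb| ≤ 2`). -/
def barlowNbrBox (u : Idx) : Finset Idx := barlowBox u 1 3 2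

/-- The piece radius at scale `D`, as an integer numerator over `2D`: `D` for a bond (`ν/2`), `0` otherwise. -/
def pieceRadiusN (s : ℤ → ℤ) (D : ℕ) (k : Idx × Idx) : ℤ := if barlowSiteForm s k.1 k.2 = 12 then D else 0

/-- The star form of a site against a pair: `2F(u,a) + 2F(u,b) − F(a,b)` (`= 48·dist(site u, midpoint)²/ν²`). -/
def barlowStarForm (s : ℤ → ℤ) (u : Idx) (k : Idx × Idx) : ℤ :=
  2 * barlowSiteForm s u k.1 + 2 * barlowSiteForm s u k.2 - barlowSiteForm s k.1 k.2

variable {s : ℤ → ℤ} {ν : ℝ} {q : E3} {R : E3 ≃ₗᵢ[ℝ] E3}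

/-- support: box membership from squared coordinate bounds. [this file] -/
theorem mem_barlowBox_of_sq_lt {u u₀ : Idx} {Ll La Lb : ℕ} (hl : (u.1 - u₀.1) ^ 2 < ((Ll : ℤ) + 1) ^ 2)
    (ha : (u.2.1 - u₀.2.1) ^ 2 < ((La : ℤ) + 1) ^ 2) (hb : (u.2.2 - u₀.2.2) ^ 2 < ((Lb : ℤ) + 1) ^ 2) :
    u ∈ barlowBox u₀ Ll La Lb := by
  have h1 := abs_lt.1 (abs_lt_of_sq_lt_sq hl (by positivity))
  have h2 := abs_lt.1 (abs_lt_of_sq_lt_sq ha (by positivity))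
  have h3 := abs_lt.1 (abs_lt_of_sq_lt_sq hb (by positivity))
  simp only [barlowBox, Finset.mem_product, mem_barlowRange_iff]
  omega

/-- support ★ (completeness of the core box): a site of form `≤ K` about `u₀` lies in `barlowBox u₀ Ll La Lb` as soon as
`K < 8(Ll+1)²`, `13K < 24(La+1)²`, `K < 4(Lb+1)²` (at `K = 1728`: `Ll = 14`, `La = 30`, `Lb = 20`). [«CollarForms»] -/
theorem mem_barlowBox_of_form_le (hs : IsHaggSeq s) {u u₀ : Idx} {K : ℤ} {Ll La Lb : ℕ} (hK : barlowSiteForm s u u₀ ≤ K)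
    (hl : K < 8 * ((Ll : ℤ) + 1) ^ 2) (ha : 13 * K < 24 * ((La : ℤ) + 1) ^ 2) (hb : K < 4 * ((Lb : ℤ) + 1) ^ 2) :
    u ∈ barlowBox u₀ Ll La Lb := by
  obtain ⟨h1, h2, h3⟩ := coord_sq_le_of_barlowSiteForm_le hs hK
  exact mem_barlowBox_of_sq_lt (by linarith) (by linarith) (by linarith)

/-- support: the neighbour box is complete for form `≤ 24`. [«CollarForms»] -/
theorem mem_barlowNbrBox_of_form_le (hs : IsHaggSeq s) {u u' : Idx} (h : barlowSiteForm s u' u ≤ 24) : u' ∈ barlowNbrBox u :=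
  mem_barlowBox_of_form_le hs h (by norm_num) (by norm_num) (by norm_num)

/-- support: the form is symmetric. [«CollarSites»] -/
theorem barlowSiteForm_comm (s : ℤ → ℤ) (u u' : Idx) : barlowSiteForm s u u' = barlowSiteForm s u' u := by
  unfold barlowSiteForm; ring

/-- support: the piece radius at scale `D`. [this file] -/
theorem pieceRadius_eq (s : ℤ → ℤ) (ν : ℝ) {D : ℕ} (hD : 0 < D) (k : Idx × Idx) :
    pieceRadius s ν k = ν * (pieceRadiusN s D k : ℝ) / (2 * D) := by
  have hD' : (D : ℝ) ≠ 0 := by positivity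
  unfold pieceRadius pieceRadiusN
  split_ifs
  · push_cast; field_simp
  · push_cast; simp

/-- support: the integer piece radius is nonnegative. [this file] -/
theorem pieceRadiusN_nonneg (s : ℤ → ℤ) (D : ℕ) (k : Idx × Idx) : 0 ≤ pieceRadiusN s D k := by
  unfold pieceRadiusN; split_ifs <;> simp

/-! ## §2 Soundness of the finite conditions -/

/-- support: core membership about a reference site is the integer test `F(u,u₀) ≤ Kc` (`Kc = 12ρc²`). [«CollarForms»] -/
theorem mem_collarCoreSites_iff (hν : 0 < ν) {ρc : ℝ} (hρ : 0 ≤ ρc) {Kc : ℤ} (hKc : (Kc : ℝ) = 12 * ρc ^ 2) (u₀ u : Idx) :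
    u ∈ collarCoreSites s ν q R (placedSite s ν q R u₀) (ν * ρc) ↔ barlowSiteForm s u u₀ ≤ Kc := by
  rw [← @Int.cast_le ℝ, hKc]
  exact dist_placedSite_le_scale_iff hν hρ u u₀

/-- ★★ hI OF THE INTERFACE ROW FROM (A1): with the core keyed by the integer test about the site `u₀` (`r_c = ν·ρc`,
`Kc = 12ρc²`) and complete boxes, the finite condition (A1) gives: every (core, non-core) pair of form `≤ 24` is listed.
[this file] -/
theorem hI_of_atlas (hs : IsHaggSeq s) (hν : 0 < ν) (u₀ : Idx) {ρc : ℝ} (hρ : 0 ≤ ρc) {Kc : ℤ} (hKc : (Kc : ℝ) = 12 * ρc ^ 2)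
    {Ll La Lb : ℕ} (hl : Kc < 8 * ((Ll : ℤ) + 1) ^ 2) (ha : 13 * Kc < 24 * ((La : ℤ) + 1) ^ 2) (hb : Kc < 4 * ((Lb : ℤ) + 1) ^ 2)
    (I : Finset (Idx × Idx))
    (A1 : ∀ u ∈ barlowBox u₀ Ll La Lb, barlowSiteForm s u u₀ ≤ Kc → ∀ u' ∈ barlowNbrBox u, barlowSiteForm s u u' ≤ 24 →
      Kc < barlowSiteForm s u' u₀ → (u, u') ∈ I) :
    ∀ u ∈ collarCoreSites s ν q R (placedSite s ν q R u₀) (ν * ρc),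
      ∀ u' ∉ collarCoreSites s ν q R (placedSite s ν q R u₀) (ν * ρc), barlowSiteForm s u u' ≤ 24 → (u, u') ∈ I := by
  intro u hu u' hu' hF
  rw [mem_collarCoreSites_iff hν hρ hKc] at hu hu'
  exact A1 u (mem_barlowBox_of_form_le hs hu hl ha hb) hu u' (mem_barlowNbrBox_of_form_le hs (by rwa [barlowSiteForm_comm])) hF
    (lt_of_not_ge hu')

/-- ★★ hWd AND hW0 OF THE INTERFACE ROW FROM (A3), (A4): widths `w u = ν·wN u/D` with `wN ≥ 0` supported on `B`, books
`W k = ν·WN k/D`, `r₀ = ν/√2 ≤ ν·cN/D`; the integer star test over-approximates the real one (Apollonius in integer form), so (A3)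
on `B` and (A4) give the star domination for EVERY site. [this file] -/
theorem hWd_of_atlas (hν : 0 < ν) {r₀ : ℝ} (hr₀ : r₀ = ν / Real.sqrt 2) (I : Finset (Idx × Idx)) (B : Finset Idx) {D : ℕ}
    (hD : 0 < D) {cN : ℤ} (hcN : 0 ≤ cN) (hc : (D : ℤ) ^ 2 ≤ 2 * cN ^ 2) (wN : Idx → ℤ) (WN : Idx × Idx → ℤ)
    (hw0 : ∀ u, 0 ≤ wN u) (hwB : ∀ u ∉ B, wN u = 0)
    (A3 : ∀ u ∈ B, ∀ k ∈ I, (D : ℤ) ^ 2 * barlowStarForm s u k ≤ 12 * (2 * cN + 4 * wN u + pieceRadiusN s D k) ^ 2 → wN u ≤ WN k)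
    (A4 : ∀ k ∈ I, 0 ≤ WN k) :
    (∀ k ∈ I, (0 : ℝ) ≤ ν * (WN k : ℝ) / D) ∧
      ∀ u, ∀ k ∈ I, dist (placedSite s ν q R u) (midpoint ℝ (placedSite s ν q R k.1) (placedSite s ν q R k.2)) ≤
        r₀ + 2 * (ν * (wN u : ℝ) / D) + pieceRadius s ν k → ν * (wN u : ℝ) / D ≤ ν * (WN k : ℝ) / D := by
  have hDr : (0 : ℝ) < D := by exact_mod_cast hD
  have hW0 : ∀ k ∈ I, (0 : ℝ) ≤ ν * (WN k : ℝ) / D := fun k hk =>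
    div_nonneg (mul_nonneg hν.le (by exact_mod_cast A4 k hk)) hDr.le
  refine ⟨hW0, fun u k hk hd => ?_⟩
  by_cases hu : u ∈ B
  · -- 1/√2 ≤ cN/D
    have hsqrt : 1 / Real.sqrt 2 ≤ (cN : ℝ) / D := by
      have h2 : (0 : ℝ) < Real.sqrt 2 := by positivity
      rw [div_le_div_iff₀ h2 hDr, one_mul]
      have hc' : ((D : ℤ) ^ 2 : ℝ) ≤ (2 * cN ^ 2 : ℤ) := by exact_mod_cast hc
      push_cast at hc'
      have hcNr : (0 : ℝ) ≤ cN := by exact_mod_cast hcN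
      have h0 : (0 : ℝ) ≤ (cN : ℝ) * Real.sqrt 2 := by positivity
      nlinarith [Real.sq_sqrt (zero_le_two (α := ℝ))]
    -- the real star radius is at most ν·t, t = (2cN + 4 wN u + ρN k)/(2D)
    set num : ℤ := 2 * cN + 4 * wN u + pieceRadiusN s D k with hnum
    set t : ℝ := (num : ℝ) / (2 * D) with ht
    have hnum0 : (0 : ℝ) ≤ num := by
      rw [hnum]; have := hw0 u; have := pieceRadiusN_nonneg s D k; push_cast; positivity
    have ht0 : 0 ≤ t := by rw [ht]; positivity
    have htT : r₀ + 2 * (ν * (wN u : ℝ) / D) + pieceRadius s ν k ≤ ν * t := by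
      rw [ht, hnum, hr₀, pieceRadius_eq s ν hD]
      push_cast
      have e : ν * ((2 * cN + 4 * wN u + pieceRadiusN s D k : ℝ) / (2 * D)) =
          ν * ((cN : ℝ) / D) + 2 * (ν * (wN u : ℝ) / D) + ν * (pieceRadiusN s D k : ℝ) / (2 * D) := by
        field_simp; ring
      rw [e]
      have : ν / Real.sqrt 2 = ν * (1 / Real.sqrt 2) := by ring
      rw [this]
      nlinarith [mul_le_mul_of_nonneg_left hsqrt hν.le]
    have hreal := (dist_placedSite_midpoint_le_iff (s := s) (q := q) (R := R) hν.le (by positivity : 0 ≤ ν * t) u k.1 k.2).1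
      (hd.trans htT)
    rw [form_le_iff_of_scale hν, ht] at hreal
    -- clear the denominator: X ≤ 48 (num/(2D))² ↔ D²·X ≤ 12·num²
    have hreal' : ((D : ℤ) ^ 2 * barlowStarForm s u k : ℤ) ≤ ((12 * num ^ 2 : ℤ) : ℝ) := by
      push_cast
      unfold barlowStarForm
      push_cast
      have hD2 : (0 : ℝ) < (D : ℝ) ^ 2 := by positivity
      have key : (2 * (barlowSiteForm s u k.1 : ℝ) + 2 * (barlowSiteForm s u k.2 : ℝ) - (barlowSiteForm s k.1 k.2 : ℝ)) *
          (D : ℝ) ^ 2 ≤ 48 * ((num : ℝ) / (2 * D)) ^ 2 * (D : ℝ) ^ 2 := mul_le_mul_of_nonneg_right hreal hD2.le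
      have e : 48 * ((num : ℝ) / (2 * D)) ^ 2 * (D : ℝ) ^ 2 = 12 * (num : ℝ) ^ 2 := by
        field_simp; ring
      rw [e] at key
      linarith
    have hint : (D : ℤ) ^ 2 * barlowStarForm s u k ≤ 12 * num ^ 2 := by exact_mod_cast hreal'
    have hq := A3 u hu k hk hint
    have : (wN u : ℝ) ≤ WN k := by exact_mod_cast hq
    exact div_le_div_of_nonneg_right (mul_le_mul_of_nonneg_left this hν.le) hDr.le
  · rw [hwB u hu]; push_cast; rw [mul_zero, zero_div]; exact hW0 k hk

end

end Summit.AtomisticToContinuum.Crystallization.Theorems.OverbindingBudgetAffineFarFieldCollarAtlas
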